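import Mathlib
import Summits.MatrixMultiplication.MatrixMultiplication.Theses.LevelGradedCohnUmans
import Literature.RepresentationTheory.FiniteGroups.SymmetricGroupCosetSpan
import Literature.RepresentationTheory.FiniteGroups.VershikKerovMaxDegree
import Summits.MatrixMultiplication.MatrixMultiplication.Theorems.SnLevelDesigns.Negative.DeadCorners
import Summits.MatrixMultiplication.MatrixMultiplication.Theorems.SnLevelDesigns.Negative.DimensionWalls
import Summits.MatrixMultiplication.MatrixMultiplication.Theorems.SnLevelDesigns.Negative.CoveringWall
import Summits.MatrixMultiplication.MatrixMultiplication.Theorems.SnLevelDesigns.Negative.NeumannLevelK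

/-!
# Line `lis-bruhat-shield` — skeleton for the crux `LevelGradedCohnUmans.SnLevelDesigns`
(crux item stmt-MatrixMultiplication-7613, rank 4; planner crux-plan seat, round 1; merged with the
triage-identical lever of card `kl-schensted-certificate`, whose guarded statements are adopted)

THE LINE.  Write `J_k ≤ ℂ^{𝔖ₙ}` for the `k`-token test space (`= kCosetSpan n k`, EFP Thm 7) and
`B_k = {g ∈ 𝔖ₙ : lis g ≥ n - k}` for the SCHENSTED SET (`#B_k = D_k(n) = ∑_{μ₁ ≥ n-k} (f^μ)² = dim J_k`).
(A) `B_k` is an interpolation set for `J_k` (Raghavan–Samuel–Subrahmanyam, RSK bases, Thm 2 at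
`λ = (n-k,1^k)`: `B_k` is a basis of `ℂ𝔖ₙ/J_k^⊥`) — `stub_schenstedInterpolates`;
(B) modulo `J_k^⊥` every permutation `s` straightens into Schensted permutations lying Bruhat-BELOW
`s` (Kazhdan–Lusztig unitriangularity of the cell-ideal basis `{C_w : shape(w)₁ < n-k}` of `J_k^⊥`) —
`stub_shadowStraightening`.
(A)+(B) give the BRUHAT-SHIELD CERTIFICATE (`shield_separated`, kernel-checked below): if every
target `x⁻¹z` lies in `B_k` and every non-target quadruple product `p = x⁻¹yy'⁻¹z` differs from the
target `t = x₀⁻¹z₀` and is either itself in `B_k` or NOT Bruhat-above `t`, then the dual-basis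
functional `f_t ∈ J_k` of `t` separates: the triple is `k`-token separated.  So the crux's linear
algebra in dimension `D_k ≈ n^{2k}/k!` is replaced by an ORDER condition on permutations, and the
open content of the crux becomes one ε-free extremal problem on permutation patterns:
(C) `stub_shieldDesigns` (THE HARDEST STUB, open): along `k → ∞` (with `n ≥ k²`) there are shielded
triples of volume `(|X||Y||Z|)^{1/3} ≥ e^{-c√k} · C(n,k) · √(k!)` for every `c > 0` — i.e. within
`e^{-o(√k)}` per set of the graded wall `√D_k ≍ C(n,k)√(k!)`;
(D) `stub_wallForm` (Vershik–Kerov budget collapse, provable now): any `k`-token separated family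
that close to the wall satisfies the crux inequality `∑_{μ₁≥n-k}(f^μ)^{2+ε} < V^{(2+ε)/3}` for EVERY
`ε > 0` (budget `≤ F^ε·D_k`, `D_k ≤ (k+1)C(n,k)²k!`, and `F = max_{μ₁≥n-k} f^μ ≤ C(n,k)√(k!)·A e^{-c'√k}`
for `n ≥ k²` by first-row peeling `f^{(n-j,ν)} ≤ C(n,j) f^ν` and the tree theorem
`VershikKerov1985_maxCharDegree_holds`).
`SnLevelDesigns_of` composes (A) (B) (C) (D) into the crux BY NAME with a real proof
(the certificate + quantifier plumbing; no `sorry` outside the four `stub_*`).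

CONVENTIONS (checked numerically by four independent implementations, n ≤ 8, incl. this seat's
`compute/convention_check.py` which implements the Lean formulas below verbatim):
`bruhatLE v w` is the Björner–Brenti rank criterion (Thm 2.1.5) oriented so that the identity is
the BOTTOM element; `(g * h) i = g (h i)`; products are read `x⁻¹ * y * y'⁻¹ * z` as in the crux.

DISPROOF USED (`Cruxes/SnLevelDesigns/Disproof.lean`, cdisprove v3, NO KILL, no
`_false_without_` theorem exists for this crux): the line CONCLUDES the crux's separation clause
verbatim (`KTokenSeparated = Negative.Sep`, `kTokenSeparated_iff_sep` below), never weakens `<`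
(`at_le_version_trivial`) and never drops separation (`exists_budget_lt_volPow`); levels 0 and 1
(`not_at_level_zero`, `not_at_level_one`) and every fixed level (graded Neumann, `neumann_X/Z`,
sibling refutation `LevelGradedCohnUmansLevelTwoBeatsCubes_refuted`) are irrelevant because (C) is a
`k → ∞` statement; the dimension walls apply to shielded designs (`shield_volume_sq_le`, derived
below FROM the landed `Negative.volume_sq_le_finrank_cube`), so (C) asks for nothing beyond
`V ≤ (dim J_k)^{3/2}`; the `(ℤ/2)^{k+1}`-coset obstruction (`exists_coset_point_not_mem_quot`) can
only fire through products OUTSIDE `B_k` (`B_k` is coset-free), i.e. exactly through the garbage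
the shield keeps Bruhat-incomparable.  Negatives index: the four refuted statements of the summit
(level-2-beats-cubes, two finite-field STPP designs, design flattening) are not instances of any stub.

TRIAGE ANSWERS (r1-1/2/3, all pass + merge with kl-schensted-certificate): guards `k ≤ n` everywhere
(`Corner1.lean`/`N0self.lean` junk at `n = 0 < k` is gone: (C) has `n ≥ k² ≥ k`, (A)/(B) carry
`k ≤ n`); clause (iii) in the sharper per-target form "`p ∈ B_k ∨ t ≰_B p`"; the ε-step is a
provable-now stub citing the PROVED VK theorem; the tableaux numbers are moved out of the design
stub entirely (proxy wall `C(n,k)√(k!)`, so (C) is purely combinatorial).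
-/

set_option linter.dupNamespace false

noncomputable section

open scoped BigOperators

namespace Summit.MatrixMultiplication.MatrixMultiplication.Cruxes.SnLevelDesigns.LisBruhatShield

open Literature.RepresentationTheory.FiniteGroups (kCoset kCosetSpan)

variable {n : ℕ}

/-! ## Objects -/

/-- The crux's separation clause, verbatim (first conjunct of `SnLevelDesigns` at fixed `n, k`). -/
def KTokenSeparated (n k : ℕ) (X Y Z : Finset (Equiv.Perm (Fin n))) : Prop :=
  ∀ x₀ ∈ X, ∀ z₀ ∈ Z, ∃ c : (Fin k → Fin n) → (Fin k → Fin n) → ℂ,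
    ∀ x ∈ X, ∀ y ∈ Y, ∀ y' ∈ Y, ∀ z ∈ Z,
      (∑ p : Fin k → Fin n, c p (⇑(x⁻¹ * y * y'⁻¹ * z) ∘ p)) =
        if x = x₀ ∧ y = y' ∧ z = z₀ then 1 else 0

/-- `g` has an increasing subsequence of length `≥ m`. -/
def HasIncSubseq (g : Equiv.Perm (Fin n)) (m : ℕ) : Prop :=
  ∃ s : Finset (Fin n), m ≤ s.card ∧ StrictMonoOn (⇑g) (s : Set (Fin n))

/-- The **Schensted set** `B_k(n) = {g ∈ 𝔖ₙ : lis(g) ≥ n - k}` (`#B_k = ∑_{μ₁ ≥ n-k} (f^μ)² = dim J_k`,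
Schensted 1961 + Ellis–Friedgut–Pilpel Thm 7). -/
def schenstedSet (n k : ℕ) : Set (Equiv.Perm (Fin n)) := {g | HasIncSubseq g (n - k)}

/-- Strong Bruhat order on `𝔖ₙ`, rank-matrix criterion (Björner–Brenti Thm 2.1.5), oriented with the
identity at the BOTTOM: `v ≤_B w` iff `#{a < i : w a < j} ≤ #{a < i : v a < j}` for all `i, j`. -/
def bruhatLE (v w : Equiv.Perm (Fin n)) : Prop :=
  ∀ i j : ℕ,
    (Finset.univ.filter (fun a : Fin n => (a : ℕ) < i ∧ ((w a : Fin n) : ℕ) < j)).card ≤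
      (Finset.univ.filter (fun a : Fin n => (a : ℕ) < i ∧ ((v a : Fin n) : ℕ) < j)).card

/-- Shield clause (L): every target `x⁻¹ z` lies in the Schensted set. -/
def TargetsSchensted (n k : ℕ) (X Z : Finset (Equiv.Perm (Fin n))) : Prop :=
  ∀ x ∈ X, ∀ z ∈ Z, x⁻¹ * z ∈ schenstedSet n k

/-- Shield clause (S), sharpened per-target form (triage r1-1/2/3): for every target `t = x₀⁻¹z₀` and
every other quadruple, the product `p = x⁻¹yy'⁻¹z` is not `t`, and is either Schensted or NOT
Bruhat-above `t`.  (Contains target-distinctness and the TPP shadow.) -/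
def BruhatShield (n k : ℕ) (X Y Z : Finset (Equiv.Perm (Fin n))) : Prop :=
  ∀ x₀ ∈ X, ∀ z₀ ∈ Z, ∀ x ∈ X, ∀ y ∈ Y, ∀ y' ∈ Y, ∀ z ∈ Z, ¬ (x = x₀ ∧ y = y' ∧ z = z₀) →
    x⁻¹ * y * y'⁻¹ * z ≠ x₀⁻¹ * z₀ ∧
      (x⁻¹ * y * y'⁻¹ * z ∈ schenstedSet n k ∨ ¬ bruhatLE (x₀⁻¹ * z₀) (x⁻¹ * y * y'⁻¹ * z))

/-- The proxy graded wall per set, `C(n,k) · √(k!)` (`≍ √D_k(n)` for `n ≥ k²`), discounted by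
`e^{-c√k}`. -/
def proxyWall (c : ℝ) (n k : ℕ) : ℝ :=
  Real.exp (-(c * Real.sqrt k)) * ((n.choose k : ℝ) * Real.sqrt (k.factorial : ℝ))

/-! ## The four stub statements (named `Prop`s) -/

/-- STUB A — Raghavan–Samuel–Subrahmanyam 2012 (arXiv:0902.2842) Thm 2 at `λ = (n-k,1^k)`,
interpolation form: every function on the Schensted set is the restriction of a `k`-token test
function (the evaluations at `B_k` are linearly independent on `J_k = kCosetSpan n k`). -/
def SchenstedInterpolates : Prop :=
  ∀ (n k : ℕ), k ≤ n → ∀ c : Equiv.Perm (Fin n) → ℂ,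
    ∃ f ∈ kCosetSpan n k, ∀ g ∈ schenstedSet n k, f g = c g

/-- STUB B — Kazhdan–Lusztig shadow straightening: modulo `J_k^⊥` every permutation `s` is a
combination of Schensted permutations lying Bruhat-BELOW `s` (KL79 Thm 1.1 unitriangularity of
`C_w` + the cell ideal `J_k^⊥ = ⟨C_w : shape(w)₁ < n-k⟩`, RSS12 §3.2.2/(5.1)). -/
def ShadowStraightening : Prop :=
  ∀ (n k : ℕ), k ≤ n → ∀ s : Equiv.Perm (Fin n),
    ∃ c : Equiv.Perm (Fin n) → ℂ,
      (∀ b, c b ≠ 0 → b ∈ schenstedSet n k ∧ bruhatLE b s) ∧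
        ∀ f ∈ kCosetSpan n k, f s = ∑ b, c b * f b

/-- STUB C (hardest, open) — BRUHAT-SHIELD DESIGNS NEAR THE WALL: for every `c > 0` there are
arbitrarily large levels `k`, some `n ≥ k²` and a shielded triple `X, Y, Z ⊆ 𝔖ₙ` (clauses (L), (S))
with `(|X||Y||Z|)^{1/3} ≥ e^{-c√k} · C(n,k) · √(k!)`.  Purely combinatorial (no tableaux, no ℂ). -/
def ShieldDesigns : Prop :=
  ∀ c : ℝ, 0 < c → ∀ k₀ : ℕ, ∃ k : ℕ, k₀ ≤ k ∧ ∃ n : ℕ, k ^ 2 ≤ n ∧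
    ∃ X Y Z : Finset (Equiv.Perm (Fin n)),
      TargetsSchensted n k X Z ∧ BruhatShield n k X Y Z ∧
        proxyWall c n k ≤ ((X.card * Y.card * Z.card : ℕ) : ℝ) ^ ((1 : ℝ) / 3)

/-- The ε-free WALL FORM of the crux (target of STUB D): `k`-token separated triples within
`e^{-o(√k)}` per set of the proxy wall, along `k → ∞`, `n ≥ k²`. -/
def NearWallSeparated : Prop :=
  ∀ c : ℝ, 0 < c → ∀ k₀ : ℕ, ∃ k : ℕ, k₀ ≤ k ∧ ∃ n : ℕ, k ^ 2 ≤ n ∧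
    ∃ X Y Z : Finset (Equiv.Perm (Fin n)),
      KTokenSeparated n k X Y Z ∧
        proxyWall c n k ≤ ((X.card * Y.card * Z.card : ℕ) : ℝ) ^ ((1 : ℝ) / 3)

/-- STUB D — VERSHIK–KEROV BUDGET COLLAPSE: the wall form implies the crux.  Content: budget
`∑_{μ₁≥n-k}(f^μ)^{2+ε} ≤ F^ε · D_k(n)`; `D_k(n) ≤ (k+1)·C(n,k)²·k!` (first-row peeling
`f^{(n-j,ν)} ≤ C(n,j) f^ν` and `∑_{ν⊢j}(f^ν)² = j!`); `F ≤ C(n,k)√(k!)·A·e^{-c'√k}` for `n ≥ k²`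
(peeling + `VershikKerov1985_maxCharDegree_holds`, upper half, `c' < vkUpperConst/√2`); then take
`c := c'ε/(2(2+ε))` and `k₀` large in `NearWallSeparated`. -/
def WallForm : Prop :=
  NearWallSeparated →
    Summit.MatrixMultiplication.MatrixMultiplication.Theses.LevelGradedCohnUmans.SnLevelDesigns

/-! ## The registered stubs -/

/-- STUB A (RSS12 Thm 2 at the hook-complement shape; size L: KL cells are not in Mathlib — an
elementary route is the Gram matrix `[fix(g h⁻¹)]^{(k)}` on `B_k`, or Désarménien straightening). -/
theorem stub_schenstedInterpolates : SchenstedInterpolates := by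
  sorry

/-- STUB B (KL unitriangularity + cell ideal; size L). -/
theorem stub_shadowStraightening : ShadowStraightening := by
  sorry

/-- STUB C (the construction; size XL, open — the line stands or falls here). -/
theorem stub_shieldDesigns : ShieldDesigns := by
  sorry

/-- STUB D (VK budget collapse; size M, provable now). -/
theorem stub_wallForm : WallForm := by
  sorry

/-! ## Name-keyed aliases of the four statements (hypotheses of the composition; same device as
`Cruxes/PolynomialSlack/Lines/quotient-globalisation-by-pruning.lean`) -/
namespace Registered

/-- Alias of `SchenstedInterpolates` keyed by the registered stub name. -/
abbrev stub_schenstedInterpolates : Prop := SchenstedInterpolates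
/-- Alias of `ShadowStraightening`. -/
abbrev stub_shadowStraightening : Prop := ShadowStraightening
/-- Alias of `ShieldDesigns` (`C⁺`). -/
abbrev stub_shieldDesigns : Prop := ShieldDesigns
/-- Alias of `WallForm`. -/
abbrev stub_wallForm : Prop := WallForm

end Registered

/-! ## Sanity of the objects (proved) -/

/-- `≤_B` is reflexive. -/
theorem bruhatLE_refl (v : Equiv.Perm (Fin n)) : bruhatLE v v := fun _ _ => le_rfl

/-- `≤_B` is transitive. -/
theorem bruhatLE_trans {u v w : Equiv.Perm (Fin n)} (h₁ : bruhatLE u v) (h₂ : bruhatLE v w) :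
    bruhatLE u w := fun i j => (h₂ i j).trans (h₁ i j)

/-- The identity has an increasing subsequence of every length `≤ n`; in particular `1 ∈ B_k`. -/
theorem one_mem_schenstedSet (n k : ℕ) : (1 : Equiv.Perm (Fin n)) ∈ schenstedSet n k := by
  refine ⟨Finset.univ, ?_, ?_⟩
  · simp
  · intro a _ b _ hab
    simpa using hab

/-- The Schensted sets increase with the level. -/
theorem schenstedSet_mono (n : ℕ) {k k' : ℕ} (h : k ≤ k') : schenstedSet n k ⊆ schenstedSet n k' := by
  rintro g ⟨s, hs, hmono⟩
  exact ⟨s, le_trans (Nat.sub_le_sub_left h n) hs, hmono⟩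

/-- The separation clause of this file IS the one of the landed Negative lemmas (and of the crux). -/
theorem kTokenSeparated_iff_sep (n k : ℕ) (X Y Z : Finset (Equiv.Perm (Fin n))) :
    KTokenSeparated n k X Y Z ↔
      Summit.MatrixMultiplication.MatrixMultiplication.Theorems.SnLevelDesigns.Negative.Sep n k X Y Z :=
  Iff.rfl

/-! ## The certificate: (A) + (B) ⇒ shielded triples are `k`-token separated (kernel-checked) -/

/-- Unpacking membership in the `k`-coset span into the crux's coefficient-table form
`g ↦ ∑_p c p (g ∘ p)` (after `Ideator3Sketch.tokenTable_of_mem`). -/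
theorem tokenTable_of_mem {n k : ℕ} {f : Equiv.Perm (Fin n) → ℂ} (hf : f ∈ kCosetSpan n k) :
    ∃ c : (Fin k → Fin n) → (Fin k → Fin n) → ℂ,
      ∀ g : Equiv.Perm (Fin n), (∑ p : Fin k → Fin n, c p (⇑g ∘ p)) = f g := by
  classical
  induction hf using Submodule.span_induction with
  | mem f hfS =>
    obtain ⟨a, b, rfl⟩ := hfS
    refine ⟨fun p q => if p = ⇑a ∧ q = ⇑b then 1 else 0, fun g => ?_⟩
    rw [Finset.sum_eq_single (⇑a : Fin k → Fin n)]
    · by_cases h : (⇑g ∘ ⇑a) = ⇑b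
      · have hg : g ∈ kCoset a b := fun i => congrFun h i
        simp [h, Set.indicator_of_mem hg]
      · have hg : g ∉ kCoset a b := fun hm => h (funext hm)
        simp [h, Set.indicator_of_notMem hg]
    · intro p _ hp
      simp [hp]
    · intro h
      exact absurd (Finset.mem_univ _) h
  | zero => exact ⟨0, fun g => by simp⟩
  | add f₁ f₂ _ _ ih₁ ih₂ =>
    obtain ⟨c₁, h₁⟩ := ih₁
    obtain ⟨c₂, h₂⟩ := ih₂
    exact ⟨c₁ + c₂, fun g => by simp [Finset.sum_add_distrib, h₁ g, h₂ g]⟩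
  | smul r f _ ih =>
    obtain ⟨c, h⟩ := ih
    exact ⟨r • c, fun g => by simp [← Finset.mul_sum, h g]⟩

/-- **The Bruhat-shield certificate.**  Interpolation (A) and shadow straightening (B) make every
shielded triple `k`-token separated: the dual-basis functional `f_t ∈ J_k` of the target `t ∈ B_k`
is `1` at `t`, `0` on `B_k ∖ {t}`, and `0` at every `p ∉ B_k` with `t ≰_B p` (its straightening is
supported below `p`, hence misses `t`). -/
theorem shield_separated (hInt : SchenstedInterpolates) (hStr : ShadowStraightening)
    {n k : ℕ} (hk : k ≤ n) {X Y Z : Finset (Equiv.Perm (Fin n))}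
    (hT : TargetsSchensted n k X Z) (hS : BruhatShield n k X Y Z) :
    KTokenSeparated n k X Y Z := by
  intro x₀ hx₀ z₀ hz₀
  classical
  set t := x₀⁻¹ * z₀ with ht_def
  have ht : t ∈ schenstedSet n k := hT x₀ hx₀ z₀ hz₀
  obtain ⟨f, hfJ, hfB⟩ := hInt n k hk (fun g => if g = t then 1 else 0)
  obtain ⟨c, hc⟩ := tokenTable_of_mem hfJ
  refine ⟨c, ?_⟩
  intro x hx y hy y' hy' z hz
  rw [hc]
  by_cases htarget : x = x₀ ∧ y = y' ∧ z = z₀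
  · obtain ⟨rfl, rfl, rfl⟩ := htarget
    rw [if_pos ⟨rfl, rfl, rfl⟩]
    have hprod : x⁻¹ * y * y⁻¹ * z = t := by rw [ht_def]; group
    rw [hprod, hfB t ht, if_pos rfl]
  · rw [if_neg htarget]
    obtain ⟨hne, hcase⟩ := hS x₀ hx₀ z₀ hz₀ x hx y hy y' hy' z hz htarget
    rcases hcase with hB | hnot
    · rw [hfB _ hB, if_neg hne]
    · obtain ⟨cs, hsupp, hexp⟩ := hStr n k hk (x⁻¹ * y * y'⁻¹ * z)
      rw [hexp f hfJ]
      apply Finset.sum_eq_zero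
      intro b _
      by_cases hcb : cs b = 0
      · simp [hcb]
      · obtain ⟨hbB, hble⟩ := hsupp b hcb
        rw [hfB b hbB]
        by_cases hbt : b = t
        · subst hbt
          exact absurd hble hnot
        · simp [hbt]

/-- Shielded designs give the wall form (C ⇒ the hypothesis of D), given (A) and (B). -/
theorem nearWallSeparated_of_shieldDesigns (hInt : SchenstedInterpolates)
    (hStr : ShadowStraightening) (hD : ShieldDesigns) : NearWallSeparated := by
  intro c hc k₀
  obtain ⟨k, hk, n, hn, X, Y, Z, hT, hS, hV⟩ := hD c hc k₀
  have hkn : k ≤ n := le_trans (Nat.le_self_pow two_ne_zero k) hn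
  exact ⟨k, hk, n, hn, X, Y, Z, shield_separated hInt hStr hkn hT hS, hV⟩

/-! ## Checked against the landed Negative lemmas: shielded designs obey the dimension walls and the
graded Neumann count (so STUB C asks for nothing the walls forbid: `e^{-3c√k}(C(n,k)√k!)³ ≤ V` is
compatible with `V² ≤ (dim J_k)³`, `dim J_k = D_k ≍ C(n,k)² k!`). -/

/-- The three dimension walls for a shielded triple: `(|X||Y||Z|)² ≤ (dim T_k)³`. -/
theorem shield_volume_sq_le (hInt : SchenstedInterpolates) (hStr : ShadowStraightening)
    {n k : ℕ} (hk : k ≤ n) {X Y Z : Finset (Equiv.Perm (Fin n))}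
    (hT : TargetsSchensted n k X Z) (hS : BruhatShield n k X Y Z) :
    (X.card * Y.card * Z.card) ^ 2 ≤
      Module.finrank ℂ
        (Summit.MatrixMultiplication.MatrixMultiplication.Theorems.SnLevelDesigns.Negative.tokenSpace
          n k) ^ 3 :=
  Summit.MatrixMultiplication.MatrixMultiplication.Theorems.SnLevelDesigns.Negative.volume_sq_le_finrank_cube
    (shield_separated hInt hStr hk hT hS)

/-- The graded Neumann count (`X`-slab) for a shielded triple with `Y, Z ≠ ∅`. -/
theorem shield_neumann_X (hInt : SchenstedInterpolates) (hStr : ShadowStraightening)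
    {n k : ℕ} (hk : k ≤ n) {X Y Z : Finset (Equiv.Perm (Fin n))}
    (hT : TargetsSchensted n k X Z) (hS : BruhatShield n k X Y Z)
    (hY : Y.Nonempty) (hZ : Z.Nonempty) :
    X.card * Z.card + X.card * (Y.card - 1) ≤
      Module.finrank ℂ
        (Summit.MatrixMultiplication.MatrixMultiplication.Theorems.SnLevelDesigns.Negative.tokenSpace
          n k) :=
  Summit.MatrixMultiplication.MatrixMultiplication.Theorems.SnLevelDesigns.Negative.neumann_X
    ((kTokenSeparated_iff_sep n k X Y Z).1 (shield_separated hInt hStr hk hT hS)) hY hZ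

/-! ## The composition: the four stubs imply the crux, BY NAME (kernel-checked, no `sorry`) -/

/-- **`SnLevelDesigns_of`** — `stub_schenstedInterpolates → stub_shadowStraightening →
stub_shieldDesigns → stub_wallForm → SnLevelDesigns`: the shield designs (C) are `k`-token
separated by the certificate built from (A) and (B) (`shield_separated`), hence form a near-wall
separated family (`nearWallSeparated_of_shieldDesigns`), which the Vershik–Kerov budget collapse (D)
turns into the crux for every `ε > 0`. -/
theorem SnLevelDesigns_of (h₁ : Registered.stub_schenstedInterpolates)
    (h₂ : Registered.stub_shadowStraightening) (h₃ : Registered.stub_shieldDesigns)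
    (h₄ : Registered.stub_wallForm) :
    Summit.MatrixMultiplication.MatrixMultiplication.Theses.LevelGradedCohnUmans.SnLevelDesigns :=
  h₄ (nearWallSeparated_of_shieldDesigns h₁ h₂ h₃)

/-- Wiring check: the registered stubs feed `SnLevelDesigns_of` as stated. -/
example : Summit.MatrixMultiplication.MatrixMultiplication.Theses.LevelGradedCohnUmans.SnLevelDesigns :=
  SnLevelDesigns_of stub_schenstedInterpolates stub_shadowStraightening stub_shieldDesigns
    stub_wallForm

end Summit.MatrixMultiplication.MatrixMultiplication.Cruxes.SnLevelDesigns.LisBruhatShield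

end
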